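import Summits.QuantumFields.YangMills.Theorems.BalabanUVNodesN19CoreProductBlocks

/-!
# BalabanUVNodes ∕ N19 (NE7) — THE PRODUCT CALCULUS OF THE HYBRID NE7 DATUM, III: POINTWISE PRODUCTS ON ONE INDEX AND SKEW
# (FIBRED) PRODUCTS — `Core` of a datum whose fibre over each base class carries its OWN conditional datum; the load-bearing clause
# «ONE constant for ALL base points» made explicit, priced (base-point dependence of the fibre constants is booked into the radius by
# its oscillation), and shown necessary (two exactly matched fibres with constants `±M` force radius `≥ M` on the skew product)

Cell `pub-ymgap` (HUMAN RULING D-0062 Track A; D-0149 width push, director-ym №197), seat `pub-ymgap-dag-n19-w2` (WIDTH SEAT 2 of 3 on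
NODE n19 = NE7) gen 2.  Filed `--kind proof --supports stmt-QuantumFields-20544 --as helper` (K3⁷ `SpineGivenEndpointR13SepCoPH`);
COUNT-NEUTRAL.  Files I ∕ II = `…N19CoreProductBlocks` (p593172) ∕ `…N19CoreProductBlockFamily` (independent blocks).

WHY THIS FILE.  [Balaban1988Convergent] (2.18)'s history-indexed expansion is NOT a product over independent blocks but a SKEW product
over SCALES: a term is a history `(Λ₁, …, Λ_K)` and each step's large-field decomposition is CONDITIONAL on the earlier entries.  The
zeroth-order skeleton of a scale-by-scale proof of node U5's `Core` is therefore the composition of `Core` along a FIBRATION: a base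
datum (the history up to the previous step, classes `T₁ K`, weights `P₁ ∕ Q₁` for the two runs) and, over every base class `i`, a fibre
datum (the next step's classes `T₂ i K`, bad fibre classes `Bad₂ i K t`, conditional weights `P₂ i ∕ Q₂ i`); the skew product has classes
`(T₁ K).sigma (T₂ · K)`, weights `P₁(i)·P₂(i, y)`, and a dependent pair is BAD iff its base is bad or its fibre point is bad.  What is typed:
* §1 `core_mul` — the primitive: two matched data ON THE SAME INDEX multiply pointwise (bad classes unite, constants add, radii add;
  run A's good cores nonnegative).  Instance `δ′ = 0`: a factor matched EXACTLY (identical characteristic functions after King's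
  synchronisation, [King1986] (3.10)–(3.13) template) costs no radius — cf. n19-d's `…N19CoreMetric.core_common_mul_iff` (a COMMON
  positive factor) and `T4HybridMatching.prod_sandwich` (factors INSIDE one term); files I∕II's block products are `core_mul` of two
  pullbacks;
* §2 `core_pullback_sigma` — a base datum pulled back to the sigma type along the first projection keeps its constant and radius;
* §3 ★ `core_sigma` — base `Core` (radius `vol₁·δ₁`) ⊗ the fibre family AS ONE DATUM on the sigma type (radius `vol₂·δ₂`: ONE constant
  `c₂(K)` for ALL base points `i` — the load-bearing uniformity, = `T4MatchingAssembly` §1's «one `c_K` per `K`, any class- or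
  `t`-dependence being booked into the width») ⟹ `Core` of the skew product, constants `c₁ + c₂`, radius `vol₁·δ₁ + vol₂·δ₂`;
  ★ `core_sigmaFibres_of_osc` — the PRICE of base-point dependence: fibrewise sandwiches with constants `c₂(K, i)` whose oscillation
  about a centre is `≤ ω_K` give the fibre-family datum with radius `vol₂·δ₂ + ω` (so `core_sigma` applies with that radius);
  ★ `le_of_core_sigmaFibres_twoFibre` ∕ `not_core_sigmaFibres_twoFibre_of_lt` — NECESSITY: two single-point fibres matched EXACTLY
  (`δ₂ = 0`) with constants `+M` and `−M` are, as ONE datum, matched at NO radius `< M`: per-fibre (per-history) matching with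
  history-DEPENDENT constants books NOTHING toward node U5's `Core` beyond the oscillation of those constants;
* §4 `relWeightBound_sigma` — NE7b along the fibration: base `RelWeightBound` for the MARGINAL weights `A₁(i)·Σ_{T₂ i} A₂(i,·)` (bad
  weight `W₁`) and a fibrewise `RelWeightBound` UNIFORM in the base point (bad weight `W₂`) give the skew product's with
  `W₁ + W₂ − W₁W₂` (nonnegative term weights).
All [folklore] finite-sum bookkeeping (`Finset.sigma`, `Finset.sum_sigma`, `Finset.mem_sigma`); nothing of Bałaban's is instantiated.

HONEST FRAMING.  Count-neutral kernel bookkeeping; ZERO estimate content about Bałaban's objects — which conditional data the (2.18)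
histories carry, and whether their two-run constants ARE history-independent up to a summable oscillation, is exactly NE7's unprinted
content ([Balaban1989LargeFieldII] p.356 defers even the one-run analysis of loop observables); NE7 ∕ NE7b ∕ NE7c NOT PRINTED for d = 4
and NOT proved; N19 NOT discharged; K3⁷ OPEN, not claimed; counts UNMOVED (typed 28∕28 · discharged 5∕27 (A 5∕28)); no count claim.  One
finite 𝕋⁴ programme at fixed ε, Bałaban AS PRINTED; the YM mass gap (Clay) is NOT proved by any of this — R4 closes the conditional
finite-𝕋⁴ rung `BalabanLadder.UV` only; nothing continuum ∕ ℝ⁴ ∕ OS.  No `def`, no `instance`, no `sorry`.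
-/

noncomputable section

namespace Summit.QuantumFields.YangMills.BalabanUVNodes.N19CoreSkewProduct

open Literature.MathematicalPhysics.QuantumFieldTheory.Balaban1983to89
open T4HybridMatching T4WeightBudget T4IndicatorShell T4MatchingAssembly
open Summit.QuantumFields.BalabanUV.T4Continuum.Spine
open Summit.QuantumFields.YangMills.BalabanUVNodes.N19CoreProductBlocks (core_of_core_one)
open scoped BigOperators

/-! ## §1 POINTWISE PRODUCTS OF TWO MATCHED DATA ON ONE INDEX -/

section Mul

variable {ι : Type*} [DecidableEq ι] {l₀ vol vol' : ℝ} {T : ℕ → Finset ι} {Bad Bad' : ℕ → ℝ → Finset ι}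
  {P Q P' Q' : ℕ → ℝ → ι → ℝ} {δ δ' : ℕ → ℝ}

/-- membership in the good class of a union of bad classes. [folklore] -/
theorem mem_good_union_iff {S G G' : Finset ι} {τ : ι} : τ ∈ S \ (G ∪ G') ↔ τ ∈ S \ G ∧ τ ∈ S \ G' := by
  simp only [Finset.mem_sdiff, Finset.mem_union, not_or]
  tauto

/-- **`Core` IS CLOSED UNDER POINTWISE PRODUCTS** (same classes, bad classes unite, constants ADD, radii ADD — at `vol := 1`): two
matched data `Core l₀ vol T Bad P Q δ`, `Core l₀ vol′ T Bad′ P′ Q′ δ′` with run A's good cores nonnegative give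
`Core l₀ 1 T (Bad ∪ Bad′) (P·P′) (Q·Q′) (vol·δ + vol′·δ′)`.  With `δ′ = 0` (a factor matched EXACTLY, e.g. identical characteristic
functions) the radius is unchanged. [folklore] -/
theorem core_mul (h : NE7.Core l₀ vol T Bad P Q δ) (h' : NE7.Core l₀ vol' T Bad' P' Q' δ')
    (hP : ∀ K t, |t| ≤ l₀ → ∀ τ ∈ T K \ Bad K t, 0 ≤ P K t τ) (hP' : ∀ K t, |t| ≤ l₀ → ∀ τ ∈ T K \ Bad' K t, 0 ≤ P' K t τ) :
    NE7.Core l₀ 1 T (fun K t => Bad K t ∪ Bad' K t) (fun K t τ => P K t τ * P' K t τ) (fun K t τ => Q K t τ * Q' K t τ)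
      (fun K => vol * δ K + vol' * δ' K) := by
  intro K
  obtain ⟨c, hc⟩ := h K
  obtain ⟨c', hc'⟩ := h' K
  refine ⟨c + c', fun t ht τ hτ => ?_⟩
  obtain ⟨hτ₁, hτ₂⟩ := mem_good_union_iff.1 hτ
  obtain ⟨l₁, u₁⟩ := hc t ht τ hτ₁
  obtain ⟨l₂, u₂⟩ := hc' t ht τ hτ₂
  have hp := hP K t ht τ hτ₁
  have hp' := hP' K t ht τ hτ₂
  have hq : 0 ≤ Q K t τ := (mul_nonneg (Real.exp_pos _).le hp).trans l₁
  have elo : Real.exp (c + c' - 1 * (vol * δ K + vol' * δ' K)) = Real.exp (c - vol * δ K) * Real.exp (c' - vol' * δ' K) := by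
    rw [← Real.exp_add]; ring_nf
  have ehi : Real.exp (c + c' + 1 * (vol * δ K + vol' * δ' K)) = Real.exp (c + vol * δ K) * Real.exp (c' + vol' * δ' K) := by
    rw [← Real.exp_add]; ring_nf
  constructor
  · calc Real.exp (c + c' - 1 * (vol * δ K + vol' * δ' K)) * (P K t τ * P' K t τ)
        = (Real.exp (c - vol * δ K) * P K t τ) * (Real.exp (c' - vol' * δ' K) * P' K t τ) := by rw [elo]; ring
      _ ≤ Q K t τ * Q' K t τ := mul_le_mul l₁ l₂ (mul_nonneg (Real.exp_pos _).le hp') hq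
  · calc Q K t τ * Q' K t τ
        ≤ (Real.exp (c + vol * δ K) * P K t τ) * (Real.exp (c' + vol' * δ' K) * P' K t τ) :=
          mul_le_mul u₁ u₂ ((mul_nonneg (Real.exp_pos _).le hp').trans l₂) (mul_nonneg (Real.exp_pos _).le hp)
      _ = Real.exp (c + c' + 1 * (vol * δ K + vol' * δ' K)) * (P K t τ * P' K t τ) := by rw [ehi]; ring

/-- … at a COMMON per-volume radius `δ` the volumes ADD: `Core l₀ (vol + vol′) T (Bad ∪ Bad′) (P·P′) (Q·Q′) δ`. [folklore] -/
theorem core_mul_sameDelta {δ : ℕ → ℝ} (h : NE7.Core l₀ vol T Bad P Q δ) (h' : NE7.Core l₀ vol' T Bad' P' Q' δ)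
    (hP : ∀ K t, |t| ≤ l₀ → ∀ τ ∈ T K \ Bad K t, 0 ≤ P K t τ) (hP' : ∀ K t, |t| ≤ l₀ → ∀ τ ∈ T K \ Bad' K t, 0 ≤ P' K t τ) :
    NE7.Core l₀ (vol + vol') T (fun K t => Bad K t ∪ Bad' K t) (fun K t τ => P K t τ * P' K t τ) (fun K t τ => Q K t τ * Q' K t τ) δ :=
  core_of_core_one (by simpa only [add_mul] using core_mul h h' hP hP')

end Mul

/-! ## §2 PULLBACK OF A BASE DATUM TO THE SIGMA TYPE (weights constant along the fibres) -/

section Sigma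

variable {ι₁ : Type*} [DecidableEq ι₁] {κ : ι₁ → Type*} [∀ i, DecidableEq (κ i)] {l₀ vol₁ vol₂ : ℝ}
  {T₁ : ℕ → Finset ι₁} {Bad₁ : ℕ → ℝ → Finset ι₁} {P₁ Q₁ A₁ B₁ : ℕ → ℝ → ι₁ → ℝ} {δ₁ W₁ : ℕ → ℝ}
  {T₂ : (i : ι₁) → ℕ → Finset (κ i)} {Bad₂ : (i : ι₁) → ℕ → ℝ → Finset (κ i)} {P₂ Q₂ A₂ B₂ : (i : ι₁) → ℕ → ℝ → κ i → ℝ}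
  {δ₂ W₂ : ℕ → ℝ}

/-- a dependent pair over a base bad class (fibre point a class) has a bad base; contrapositive membership form. [folklore] -/
theorem fst_mem_good_of_mem {K : ℕ} {t : ℝ} {x : Σ i, κ i}
    (hx : x ∈ (T₁ K).sigma (fun i => T₂ i K) \ (Bad₁ K t).sigma fun i => T₂ i K) : x.1 ∈ T₁ K \ Bad₁ K t := by
  simp only [Finset.mem_sdiff, Finset.mem_sigma, not_and] at hx ⊢
  exact ⟨hx.1.1, fun h => hx.2 h hx.1.2⟩

/-- a dependent pair outside the fibrewise bad classes has a good fibre point. [folklore] -/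
theorem snd_mem_good_of_mem {K : ℕ} {t : ℝ} {x : Σ i, κ i}
    (hx : x ∈ (T₁ K).sigma (fun i => T₂ i K) \ (T₁ K).sigma fun i => Bad₂ i K t) : x.2 ∈ T₂ x.1 K \ Bad₂ x.1 K t := by
  simp only [Finset.mem_sdiff, Finset.mem_sigma, not_and] at hx ⊢
  exact ⟨hx.1.2, fun h => hx.2 hx.1.1 h⟩

/-- **PULLBACK**: a base datum `Core l₀ vol₁ T₁ Bad₁ P₁ Q₁ δ₁` read on the sigma type along the first projection (classes
`(T₁ K).sigma (T₂ · K)`, bad `(Bad₁ K t).sigma (T₂ · K)`, weights `P₁ K t x.1`) keeps its constant and its radius. [folklore] -/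
theorem core_pullback_sigma (h₁ : NE7.Core l₀ vol₁ T₁ Bad₁ P₁ Q₁ δ₁) :
    NE7.Core l₀ vol₁ (fun K => (T₁ K).sigma fun i => T₂ i K) (fun K t => (Bad₁ K t).sigma fun i => T₂ i K)
      (fun K t x => P₁ K t x.1) (fun K t x => Q₁ K t x.1) δ₁ := by
  intro K
  obtain ⟨c, hc⟩ := h₁ K
  exact ⟨c, fun t ht x hx => hc t ht x.1 (fst_mem_good_of_mem hx)⟩

/-! ## §3 SKEW (FIBRED) PRODUCTS: base ⊗ a fibre datum over every base class -/

/-- **`Core` ALONG A FIBRATION (skew product).**  Base `Core l₀ vol₁ T₁ Bad₁ P₁ Q₁ δ₁`, and the fibre family AS ONE DATUM on the sigma type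
— classes `(T₁ K).sigma (T₂ · K)`, bad `(T₁ K).sigma (Bad₂ · K t)`, weights `P₂ x.1 K t x.2`, radius `vol₂·δ₂`, i.e. for every `K` ONE
constant `c₂` for ALL base points (the load-bearing uniformity) — give, for nonnegative good cores of run A, the `Core` of the SKEW
PRODUCT: weights `P₁ K t x.1 · P₂ x.1 K t x.2`, a pair bad iff its base or its fibre point is bad, constants `c₁ + c₂`, radius
`vol₁·δ₁ + vol₂·δ₂` (at `vol := 1`).  File I's `core_prod` is the constant-fibre case. [folklore] -/
theorem core_sigma (h₁ : NE7.Core l₀ vol₁ T₁ Bad₁ P₁ Q₁ δ₁)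
    (h₂ : NE7.Core l₀ vol₂ (fun K => (T₁ K).sigma fun i => T₂ i K) (fun K t => (T₁ K).sigma fun i => Bad₂ i K t)
      (fun K t x => P₂ x.1 K t x.2) (fun K t x => Q₂ x.1 K t x.2) δ₂)
    (hP₁ : ∀ K t, |t| ≤ l₀ → ∀ i ∈ T₁ K \ Bad₁ K t, 0 ≤ P₁ K t i)
    (hP₂ : ∀ (i : ι₁) K t, |t| ≤ l₀ → ∀ y ∈ T₂ i K \ Bad₂ i K t, 0 ≤ P₂ i K t y) :
    NE7.Core l₀ 1 (fun K => (T₁ K).sigma fun i => T₂ i K)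
      (fun K t => (Bad₁ K t).sigma (fun i => T₂ i K) ∪ (T₁ K).sigma fun i => Bad₂ i K t)
      (fun K t x => P₁ K t x.1 * P₂ x.1 K t x.2) (fun K t x => Q₁ K t x.1 * Q₂ x.1 K t x.2) (fun K => vol₁ * δ₁ K + vol₂ * δ₂ K) :=
  core_mul (core_pullback_sigma h₁) h₂ (fun K t ht x hx => hP₁ K t ht x.1 (fst_mem_good_of_mem hx))
    fun K t ht x hx => hP₂ x.1 K t ht x.2 (snd_mem_good_of_mem hx)

/-- **THE PRICE OF BASE-POINT DEPENDENCE.**  If over every base class `i ∈ T₁ K` the fibre is sandwiched with ITS OWN constant `c₂ K i`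
at radius `vol₂·δ₂ K` (run A's good fibre cores nonnegative), and the constants oscillate about a centre `cbar K` by at most `ω K` on
`T₁ K`, then the fibre family is ONE matched datum on the sigma type with radius `vol₂·δ₂ + ω` (at `vol := 1`) — the class-dependence of
the constant is BOOKED INTO THE WIDTH, exactly as `T4MatchingAssembly` §1 prescribes; feed it to `core_sigma`. [folklore] -/
theorem core_sigmaFibres_of_osc {c₂ : ℕ → ι₁ → ℝ} {cbar ω : ℕ → ℝ}
    (hc : ∀ (K : ℕ) (i : ι₁), i ∈ T₁ K → ∀ t : ℝ, |t| ≤ l₀ → ∀ y ∈ T₂ i K \ Bad₂ i K t,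
      Real.exp (c₂ K i - vol₂ * δ₂ K) * P₂ i K t y ≤ Q₂ i K t y ∧ Q₂ i K t y ≤ Real.exp (c₂ K i + vol₂ * δ₂ K) * P₂ i K t y)
    (hω : ∀ K, ∀ i ∈ T₁ K, |c₂ K i - cbar K| ≤ ω K)
    (hP₂ : ∀ (i : ι₁) K t, |t| ≤ l₀ → ∀ y ∈ T₂ i K \ Bad₂ i K t, 0 ≤ P₂ i K t y) :
    NE7.Core l₀ 1 (fun K => (T₁ K).sigma fun i => T₂ i K) (fun K t => (T₁ K).sigma fun i => Bad₂ i K t)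
      (fun K t x => P₂ x.1 K t x.2) (fun K t x => Q₂ x.1 K t x.2) (fun K => vol₂ * δ₂ K + ω K) := by
  intro K
  refine ⟨cbar K, fun t ht x hx => ?_⟩
  have hi : x.1 ∈ T₁ K := (Finset.mem_sigma.1 (Finset.mem_sdiff.1 hx).1).1
  have hy := snd_mem_good_of_mem hx
  obtain ⟨l, u⟩ := hc K x.1 hi t ht x.2 hy
  have hp := hP₂ x.1 K t ht x.2 hy
  obtain ⟨hω₁, hω₂⟩ := abs_le.1 (hω K x.1 hi)
  constructor
  · calc Real.exp (cbar K - 1 * (vol₂ * δ₂ K + ω K)) * P₂ x.1 K t x.2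
        ≤ Real.exp (c₂ K x.1 - vol₂ * δ₂ K) * P₂ x.1 K t x.2 :=
          mul_le_mul_of_nonneg_right (Real.exp_le_exp.2 (by linarith)) hp
      _ ≤ Q₂ x.1 K t x.2 := l
  · calc Q₂ x.1 K t x.2 ≤ Real.exp (c₂ K x.1 + vol₂ * δ₂ K) * P₂ x.1 K t x.2 := u
      _ ≤ Real.exp (cbar K + 1 * (vol₂ * δ₂ K + ω K)) * P₂ x.1 K t x.2 :=
          mul_le_mul_of_nonneg_right (Real.exp_le_exp.2 (by linarith)) hp

end Sigma

/-! ## §3b NECESSITY: per-fibre matching with fibre-DEPENDENT constants books nothing beyond their oscillation -/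

section TwoFibre

variable {l₀ : ℝ} {M r : ℕ → ℝ}

/-- THE TWO-FIBRE WITNESS: base `Bool`, single-point fibres (`Unit`), run A ≡ 1, run B `e^{+M_K}` over `true` and `e^{−M_K}` over `false`,
no bad class.  EACH FIBRE ALONE is matched EXACTLY (radius `0`, constants `±M_K`): [folklore] -/
theorem core_twoFibre_each (b : Bool) :
    NE7.Core l₀ 1 (fun _ => (Finset.univ : Finset Unit)) (fun _ _ => ∅) (fun _ _ _ => (1 : ℝ))
      (fun K _ _ => if b then Real.exp (M K) else Real.exp (-M K)) fun _ => 0 := by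
  intro K
  refine ⟨if b then M K else -M K, fun t _ y _ => ?_⟩
  cases b <;> simp

/-- … but AS ONE DATUM on the sigma type `Σ b : Bool, Unit` any matching at radius `r` (volume `1`) has `M_K ≤ r_K` for every `K` (test
the two points at `t = 0`: `M ≤ c + r` and `c − r ≤ −M`) — so the skew product inherits radius `≥ M_K` (`core_sigma` with base ≡ 1,
`δ₁ = 0`), however well each fibre is matched on its own (`0 ≤ l₀`). [folklore] -/
theorem le_of_core_twoFibre (hl₀ : 0 ≤ l₀)
    (h : NE7.Core l₀ 1 (fun _ => (Finset.univ : Finset Bool).sigma fun _ => (Finset.univ : Finset Unit))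
      (fun _ _ => (Finset.univ : Finset Bool).sigma fun _ => (∅ : Finset Unit)) (fun _ _ _ => (1 : ℝ))
      (fun K _ x => if x.1 then Real.exp (M K) else Real.exp (-M K)) r) (K : ℕ) :
    M K ≤ r K := by
  obtain ⟨c, hc⟩ := h K
  have hmem : ∀ b : Bool, (⟨b, ()⟩ : Σ _ : Bool, Unit) ∈
      ((Finset.univ : Finset Bool).sigma fun _ => (Finset.univ : Finset Unit)) \
        (Finset.univ : Finset Bool).sigma fun _ => (∅ : Finset Unit) := fun b => by
    simp [Finset.mem_sigma]
  have ht0 : |(0 : ℝ)| ≤ l₀ := by simpa using hl₀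
  have hT := (hc 0 ht0 ⟨true, ()⟩ (hmem true)).2
  have hF := (hc 0 ht0 ⟨false, ()⟩ (hmem false)).1
  simp only [if_true, Bool.false_eq_true, if_false, mul_one, one_mul] at hT hF
  rw [Real.exp_le_exp] at hT hF
  linarith

/-- … contrapositive: at any radius with `r_K < M_K` for some `K` the two-fibre datum is matched by NO constant. [folklore] -/
theorem not_core_twoFibre_of_lt (hl₀ : 0 ≤ l₀) {K : ℕ} (hK : r K < M K) :
    ¬ NE7.Core l₀ 1 (fun _ => (Finset.univ : Finset Bool).sigma fun _ => (Finset.univ : Finset Unit))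
      (fun _ _ => (Finset.univ : Finset Bool).sigma fun _ => (∅ : Finset Unit)) (fun _ _ _ => (1 : ℝ))
      (fun K _ x => if x.1 then Real.exp (M K) else Real.exp (-M K)) r :=
  fun h => not_lt.2 (le_of_core_twoFibre hl₀ h K) hK

end TwoFibre

/-! ## §4 NE7b ALONG THE FIBRATION -/

section SigmaWeight

variable {ι₁ : Type*} [DecidableEq ι₁] {κ : ι₁ → Type*} [∀ i, DecidableEq (κ i)] {l₀ : ℝ}
  {T₁ : ℕ → Finset ι₁} {Bad₁ : ℕ → ℝ → Finset ι₁} {A₁ B₁ : ℕ → ℝ → ι₁ → ℝ} {W₁ : ℕ → ℝ}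
  {T₂ : (i : ι₁) → ℕ → Finset (κ i)} {Bad₂ : (i : ι₁) → ℕ → ℝ → Finset (κ i)} {A₂ B₂ : (i : ι₁) → ℕ → ℝ → κ i → ℝ} {W₂ : ℕ → ℝ}

/-- **`RelWeightBound` (NE7b) ALONG A FIBRATION**: a base `RelWeightBound` stated for the MARGINAL weights `A₁(i)·Σ_{y ∈ T₂ i K} A₂(i, y)`
(bad weight `W₁`), a fibrewise `RelWeightBound` UNIFORM in the base point (every conditional step's bad mass `≤ W₂`, the same `W₂` for all
`i`), and nonnegative term weights give the skew product's `RelWeightBound` with bad class «base bad OR fibre point bad» and bad weight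
`W₁ + W₂ − W₁W₂` (`< 1` and summable inherited). [folklore] -/
theorem relWeightBound_sigma
    (h₁ : RelWeightBound l₀ T₁ (fun K t i => A₁ K t i * ∑ y ∈ T₂ i K, A₂ i K t y) (fun K t i => B₁ K t i * ∑ y ∈ T₂ i K, B₂ i K t y) Bad₁ W₁)
    (h₂ : ∀ i, RelWeightBound l₀ (T₂ i) (A₂ i) (B₂ i) (Bad₂ i) W₂)
    (hA₁ : ∀ K t, |t| ≤ l₀ → ∀ i ∈ T₁ K, 0 ≤ A₁ K t i) (hB₁ : ∀ K t, |t| ≤ l₀ → ∀ i ∈ T₁ K, 0 ≤ B₁ K t i)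
    (hA₂ : ∀ (i : ι₁) K t, |t| ≤ l₀ → ∀ y ∈ T₂ i K, 0 ≤ A₂ i K t y) (hB₂ : ∀ (i : ι₁) K t, |t| ≤ l₀ → ∀ y ∈ T₂ i K, 0 ≤ B₂ i K t y)
    [Nonempty ι₁] :
    RelWeightBound l₀ (fun K => (T₁ K).sigma fun i => T₂ i K) (fun K t x => A₁ K t x.1 * A₂ x.1 K t x.2)
      (fun K t x => B₁ K t x.1 * B₂ x.1 K t x.2)
      (fun K t => (Bad₁ K t).sigma (fun i => T₂ i K) ∪ (T₁ K).sigma fun i => Bad₂ i K t) (fun K => W₁ K + W₂ K - W₁ K * W₂ K) := by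
  classical
  obtain ⟨i₀⟩ := ‹Nonempty ι₁›
  -- the one computation, for generic nonnegative base ∕ fibre families dominated as displayed
  have key : ∀ (K : ℕ) (t : ℝ), |t| ≤ l₀ → ∀ (F₁ : ι₁ → ℝ) (F₂ : (i : ι₁) → κ i → ℝ), (∀ i ∈ T₁ K, 0 ≤ F₁ i) →
      (∀ i, ∀ y ∈ T₂ i K, 0 ≤ F₂ i y) →
      (∑ i ∈ Bad₁ K t, F₁ i * ∑ y ∈ T₂ i K, F₂ i y ≤ W₁ K * ∑ i ∈ T₁ K, F₁ i * ∑ y ∈ T₂ i K, F₂ i y) →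
      (∀ i, ∑ y ∈ Bad₂ i K t, F₂ i y ≤ W₂ K * ∑ y ∈ T₂ i K, F₂ i y) →
      ∑ x ∈ (Bad₁ K t).sigma (fun i => T₂ i K) ∪ (T₁ K).sigma (fun i => Bad₂ i K t), F₁ x.1 * F₂ x.1 x.2 ≤
        (W₁ K + W₂ K - W₁ K * W₂ K) * ∑ x ∈ (T₁ K).sigma (fun i => T₂ i K), F₁ x.1 * F₂ x.1 x.2 := by
    intro K t ht F₁ F₂ hF₁ hF₂ hb₁ hb₂
    have hBT : Bad₁ K t ⊆ T₁ K := h₁.bad_subset K t ht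
    have hW₂ : 0 ≤ W₂ K := (h₂ i₀).nonneg K
    have hW₂1 : W₂ K < 1 := (h₂ i₀).lt_one K
    -- split the bad set as (base bad) ⊔ (base good, fibre bad)
    have hcover : (Bad₁ K t).sigma (fun i => T₂ i K) ∪ (T₁ K).sigma (fun i => Bad₂ i K t) =
        (Bad₁ K t).sigma (fun i => T₂ i K) ∪ (T₁ K \ Bad₁ K t).sigma (fun i => Bad₂ i K t) := by
      ext x
      simp only [Finset.mem_union, Finset.mem_sigma, Finset.mem_sdiff]
      constructor
      · rintro (h | h)
        · exact Or.inl h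
        · by_cases hb : x.1 ∈ Bad₁ K t
          · exact Or.inl ⟨hb, (h₂ x.1).bad_subset K t ht h.2⟩
          · exact Or.inr ⟨⟨h.1, hb⟩, h.2⟩
      · rintro (h | h)
        · exact Or.inl h
        · exact Or.inr ⟨h.1.1, h.2⟩
    have hdisj : Disjoint ((Bad₁ K t).sigma fun i => T₂ i K) ((T₁ K \ Bad₁ K t).sigma fun i => Bad₂ i K t) := by
      rw [Finset.disjoint_left]
      intro x hx hx'
      exact (Finset.mem_sdiff.1 (Finset.mem_sigma.1 hx').1).2 (Finset.mem_sigma.1 hx).1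
    rw [hcover, Finset.sum_union hdisj, Finset.sum_sigma, Finset.sum_sigma, Finset.sum_sigma]
    simp only [← Finset.mul_sum]
    -- base-bad part ≤ W₁ · total; fibre-bad part over good bases ≤ W₂ · (total − base-bad part)
    have hgood := Finset.sum_sdiff (f := fun i => F₁ i * ∑ y ∈ T₂ i K, F₂ i y) hBT
    have hfb : ∑ i ∈ T₁ K \ Bad₁ K t, F₁ i * ∑ y ∈ Bad₂ i K t, F₂ i y ≤
        W₂ K * ∑ i ∈ T₁ K \ Bad₁ K t, F₁ i * ∑ y ∈ T₂ i K, F₂ i y := by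
      rw [Finset.mul_sum]
      refine Finset.sum_le_sum fun i hi => ?_
      have := mul_le_mul_of_nonneg_left (hb₂ i) (hF₁ i (Finset.mem_sdiff.1 hi).1)
      linarith [this, show F₁ i * (W₂ K * ∑ y ∈ T₂ i K, F₂ i y) = W₂ K * (F₁ i * ∑ y ∈ T₂ i K, F₂ i y) by ring]
    have hbb0 : 0 ≤ ∑ i ∈ Bad₁ K t, F₁ i * ∑ y ∈ T₂ i K, F₂ i y :=
      Finset.sum_nonneg fun i hi => mul_nonneg (hF₁ i (hBT hi)) (Finset.sum_nonneg (hF₂ i))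
    nlinarith [hb₁, hfb, hgood, hbb0, hW₂, hW₂1]
  exact
  { bad_subset := fun K t ht => Finset.union_subset (Finset.sigma_mono (h₁.bad_subset K t ht) fun _ => le_rfl)
        (Finset.sigma_mono le_rfl fun i => (h₂ i).bad_subset K t ht)
    nonneg := fun K => by nlinarith [h₁.nonneg K, (h₂ i₀).nonneg K, h₁.lt_one K, (h₂ i₀).lt_one K]
    lt_one := fun K => by nlinarith [mul_pos (sub_pos.2 (h₁.lt_one K)) (sub_pos.2 ((h₂ i₀).lt_one K))]
    summable := (h₁.summable.add (h₂ i₀).summable).sub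
      (h₁.summable.of_nonneg_of_le (fun K => mul_nonneg (h₁.nonneg K) ((h₂ i₀).nonneg K))
        fun K => mul_le_of_le_one_right (h₁.nonneg K) ((h₂ i₀).lt_one K).le)
    bad_left := fun K t ht => key K t ht (A₁ K t) (fun i => A₂ i K t) (hA₁ K t ht) (fun i => hA₂ i K t ht)
      (h₁.bad_left K t ht) fun i => (h₂ i).bad_left K t ht
    bad_right := fun K t ht => key K t ht (B₁ K t) (fun i => B₂ i K t) (hB₁ K t ht) (fun i => hB₂ i K t ht)
      (h₁.bad_right K t ht) fun i => (h₂ i).bad_right K t ht }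

end SigmaWeight

end Summit.QuantumFields.YangMills.BalabanUVNodes.N19CoreSkewProduct

end
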